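import Literature.MathematicalPhysics.QuantumFieldTheory.QCDOS

/-!
# `SeaFactorisationBridge` (crux stmt-QuantumFields-13880) — negative-side support: the coupling mismatch
# between the Yang–Mills input (pure-gauge two-loop profiles) and the conclusion (`N_f`-flavour profile)

Standing-disprover extraction (cdisprove cycle 2), over the tree's `afBeta`, `betaCoeff₀`, `betaCoeff₁`,
`QCDRegularisation.scheme`, `QCDScheme.HasAsymptoticScaling`, `IsQCDAlong`.  `RobustYangMills`
quantifies over coupling sequences with `β′_k − afBeta 0 Λ′ a_k → 0`; the conclusion's `IsQCDAlong`
contains `reg.β_k − afBeta N_f Λ a_k → 0` along the SAME spacings.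

* `tendsto_afBeta_zero_sub_afBeta_atTop` — for `N_f ≥ 1` the two profiles drift apart (`→ +∞`, like
  `(N_f/12π²) log a_k⁻²`, `two_mul_betaCoeff₀_zero_sub`);
* `not_both_asymptotic_scalings`, `scheme_beta_not_pureGauge`, `isQCDAlong_beta_not_pureGauge` — no
  coupling sequence serves both; the natural strengthening "apply the Yang–Mills input at the QCD
  scheme's own couplings" has a false premise for every `Λ′`;
* `shift_tendsto_atTop` — the hand-over shift `β′_k − β_k → +∞`;
* `betaRatio_two_lt_zero`, `betaRatio_three_lt_zero`, `residual_after_oneLoop_shift_tendsto_atTop`,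
  `oneLoop_shift_not_pureGauge` — even after the exact one-loop counterterm and any constant the mismatch
  diverges like `2(b₁(0)/b₀(0) − b₁(N_f)/b₀(N_f)) log log a_k⁻²`; one-loop-shifted QCD couplings follow NO
  pure-gauge profile: the shift extracted from the sea must be TWO-LOOP exact with `o(1)` error in `β = 2/g₀²`.

Physics behind it: heavy-quark decoupling relates the Λ-parameters, `Λ_ℓ/Λ_q = P(M/Λ_q)` up to
`O((Λ/M)²)` (Athenodorou–Finkenrath–Knechtli–Korzec–Leder–Marinković–Sommer, Nucl. Phys. B 943 (2019)
114612, arXiv:1809.03383, §3); the lemmas state the size and precision of the corresponding bare-coupling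
shift at fixed spacing in the tree's normalisation.
-/

noncomputable section

namespace Summit.QuantumFields.QCD.Theorems.SeaFactorisationBridge.Negative

open Filter Topology Asymptotics
open Literature.MathematicalPhysics.QuantumFieldTheory


/-- `b₀(0) > b₀(N_f)` for `N_f ≥ 1`: quarks screen. [folklore] -/
theorem betaCoeff₀_zero_sub_pos {Nf : ℕ} (h : 1 ≤ Nf) : 0 < betaCoeff₀ 0 - betaCoeff₀ Nf := by
  unfold betaCoeff₀
  have hN : (1 : ℝ) ≤ Nf := by exact_mod_cast h
  have hπ : 0 < 16 * Real.pi ^ 2 := by positivity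
  rw [← sub_div]
  apply div_pos _ hπ
  simp only [Nat.cast_zero]
  linarith

/-- The one-loop size of the mismatch: `2 (b₀(0) − b₀(N_f)) = N_f / (12 π²)` — the coefficient of
`log a_k⁻²` in the coupling shift the bridge must extract from the sea (heavy-quark screening in the
tree's normalisation `β = 2/g₀²`). [folklore] -/
theorem two_mul_betaCoeff₀_zero_sub (Nf : ℕ) :
    2 * (betaCoeff₀ 0 - betaCoeff₀ Nf) = Nf / (12 * Real.pi ^ 2) := by
  unfold betaCoeff₀
  have hπ : Real.pi ≠ 0 := Real.pi_ne_zero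
  simp only [Nat.cast_zero]
  field_simp
  ring

/-- **The two asymptotic-freedom profiles drift apart.** For `N_f ≥ 1`, any `Λ, Λ' > 0` and any
spacings `a_k → 0⁺`: `afBeta 0 Λ' a_k − afBeta N_f Λ a_k → +∞` (it is `(N_f/12π²) log a_k⁻² + o(log a_k⁻²)`).
[folklore] -/
theorem tendsto_afBeta_zero_sub_afBeta_atTop {Nf : ℕ} (hNf : 1 ≤ Nf) {Λ Λ' : ℝ} (hΛ : 0 < Λ)
    (hΛ' : 0 < Λ') {a : ℕ → ℝ} (ha : ∀ k, 0 < a k) (ha0 : Tendsto a atTop (𝓝 0)) :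
    Tendsto (fun k => afBeta 0 Λ' (a k) - afBeta Nf Λ (a k)) atTop atTop := by
  -- L k = log (a_k⁻²) → ∞
  set L : ℕ → ℝ := fun k => Real.log ((a k ^ 2)⁻¹) with hLdef
  have hlog : ∀ M : ℝ, 0 < M → ∀ k, Real.log (1 / (a k ^ 2 * M ^ 2)) = L k + Real.log ((M ^ 2)⁻¹) := by
    intro M hM k
    rw [one_div, mul_inv,
      Real.log_mul (inv_ne_zero (pow_ne_zero 2 (ha k).ne')) (inv_ne_zero (pow_ne_zero 2 hM.ne'))]
  have hL : Tendsto L atTop atTop := by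
    have h1 : Tendsto (fun k => a k ^ 2) atTop (𝓝[>] 0) := by
      refine tendsto_nhdsWithin_iff.2 ⟨?_, Eventually.of_forall fun k => pow_pos (ha k) 2⟩
      simpa using ha0.pow 2
    exact Real.tendsto_log_atTop.comp (tendsto_inv_nhdsGT_zero.comp h1)
  have hnorm : Tendsto (fun k => ‖L k‖) atTop atTop := tendsto_norm_atTop_atTop.comp hL
  have hconst : ∀ c : ℝ, (fun _ : ℕ => c) =o[atTop] L := fun c =>
    isLittleO_const_left.2 (Or.inr hnorm)
  have hlogL : ∀ c : ℝ, (fun k => Real.log (L k + c)) =o[atTop] L := by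
    intro c
    have ht : Tendsto (fun k => L k + c) atTop atTop := tendsto_atTop_add_const_right _ c hL
    have h1 : (fun k => Real.log (L k + c)) =o[atTop] (fun k => L k + c) :=
      Real.isLittleO_log_id_atTop.comp_tendsto ht
    have h2 : (fun k => L k + c) =O[atTop] L := (isBigO_refl L atTop).add (hconst c).isBigO
    exact h1.trans_isBigO h2
  -- the decomposition D = A·L + g with g = o(L)
  set A : ℝ := 2 * (betaCoeff₀ 0 - betaCoeff₀ Nf) with hA
  have hApos : 0 < A := by rw [hA]; exact mul_pos two_pos (betaCoeff₀_zero_sub_pos hNf)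
  set cΛ : ℝ := Real.log ((Λ ^ 2)⁻¹)
  set cΛ' : ℝ := Real.log ((Λ' ^ 2)⁻¹)
  set g : ℕ → ℝ := fun k => (2 * betaCoeff₀ 0 * cΛ' - 2 * betaCoeff₀ Nf * cΛ) +
      2 * (betaCoeff₁ 0 / betaCoeff₀ 0) * Real.log (L k + cΛ') -
        2 * (betaCoeff₁ Nf / betaCoeff₀ Nf) * Real.log (L k + cΛ) with hg
  have hgo : g =o[atTop] L :=
    ((hconst _).add ((hlogL cΛ').const_mul_left _)).sub ((hlogL cΛ).const_mul_left _)
  have hgA : g =o[atTop] (fun k => A * L k) := (isLittleO_const_mul_right_iff hApos.ne').2 hgo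
  have hequiv : (fun k => A * L k + g k) ~[atTop] (fun k => A * L k) :=
    IsEquivalent.refl.add_isLittleO hgA
  have hAL : Tendsto (fun k => A * L k) atTop atTop := hL.const_mul_atTop hApos
  have hmain : Tendsto (fun k => A * L k + g k) atTop atTop := hequiv.symm.tendsto_atTop hAL
  refine hmain.congr fun k => ?_
  simp only [afBeta, hlog Λ hΛ k, hlog Λ' hΛ' k, hg, hA]
  ring

/-- **Incompatible scalings.** For `N_f ≥ 1` NO coupling sequence `β_k` follows both the `N_f`-flavour
and the pure-gauge two-loop profile along the same spacings. [folklore] -/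
theorem not_both_asymptotic_scalings {Nf : ℕ} (hNf : 1 ≤ Nf) {a : ℕ → ℝ} (ha : ∀ k, 0 < a k)
    (ha0 : Tendsto a atTop (𝓝 0)) (β : ℕ → ℝ) {Λ Λ' : ℝ} (hΛ : 0 < Λ) (hΛ' : 0 < Λ')
    (hN : Tendsto (fun k => β k - afBeta Nf Λ (a k)) atTop (𝓝 0)) :
    ¬ Tendsto (fun k => β k - afBeta 0 Λ' (a k)) atTop (𝓝 0) := by
  intro h0
  have hdiff := hN.sub h0
  have heq : (fun k => (β k - afBeta Nf Λ (a k)) - (β k - afBeta 0 Λ' (a k))) =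
      fun k => afBeta 0 Λ' (a k) - afBeta Nf Λ (a k) := by
    funext k; ring
  rw [heq, sub_zero] at hdiff
  exact not_tendsto_nhds_of_tendsto_atTop
    (tendsto_afBeta_zero_sub_afBeta_atTop hNf hΛ hΛ' ha ha0) 0 hdiff

/-- **Scheme level.** If the QCD scheme of the conclusion scales asymptotically (as `IsQCDAlong`
demands), its OWN couplings `reg.β` follow no pure-gauge profile: `RobustYangMills` can only be invoked at
shifted couplings `β′ ≠ reg.β`.  The natural strengthening of the bridge "apply the Yang–Mills input at
the QCD scheme's couplings" has a false premise for every `Λ′`. [folklore] -/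
theorem scheme_beta_not_pureGauge {Nf : ℕ} (hNf : 1 ≤ Nf) (reg : QCDRegularisation Nf)
    (m : Fin Nf → ℝ) (z shift : QCDField Nf → ℕ → ℝ)
    (h : (reg.scheme m z shift).HasAsymptoticScaling) {Λ' : ℝ} (hΛ' : 0 < Λ') :
    ¬ Tendsto (fun k => reg.β k - afBeta 0 Λ' (reg.a k)) atTop (𝓝 0) := by
  obtain ⟨Λ, hΛ, hN⟩ := h
  exact not_both_asymptotic_scalings hNf reg.a_pos reg.tendsto_a reg.β hΛ hΛ' hN

/-- The same, read off the conclusion's `IsQCDAlong` clause directly. [folklore] -/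
theorem isQCDAlong_beta_not_pureGauge {Nf : ℕ} (hNf : 1 ≤ Nf) (reg : QCDRegularisation Nf)
    (m : Fin Nf → ℝ) (z shift : QCDField Nf → ℕ → ℝ) (T : OSData (QCDField Nf) 4)
    (h : IsQCDAlong (reg.scheme m z shift) T) {Λ' : ℝ} (hΛ' : 0 < Λ') :
    ¬ Tendsto (fun k => reg.β k - afBeta 0 Λ' (reg.a k)) atTop (𝓝 0) :=
  scheme_beta_not_pureGauge hNf reg m z shift h.1 hΛ'

/-- **The hand-over shift diverges**: if `β` scales with the `N_f` profile and `β′` with the pure-gauge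
profile along the same spacings, then `β′_k − β_k → +∞`. [folklore] -/
theorem shift_tendsto_atTop {Nf : ℕ} (hNf : 1 ≤ Nf) {a : ℕ → ℝ} (ha : ∀ k, 0 < a k)
    (ha0 : Tendsto a atTop (𝓝 0)) (β β' : ℕ → ℝ) {Λ Λ' : ℝ} (hΛ : 0 < Λ) (hΛ' : 0 < Λ')
    (hN : Tendsto (fun k => β k - afBeta Nf Λ (a k)) atTop (𝓝 0))
    (h0 : Tendsto (fun k => β' k - afBeta 0 Λ' (a k)) atTop (𝓝 0)) :
    Tendsto (fun k => β' k - β k) atTop atTop := by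
  have h := tendsto_afBeta_zero_sub_afBeta_atTop hNf hΛ hΛ' ha ha0
  have h2 : Tendsto (fun k => (β' k - afBeta 0 Λ' (a k)) - (β k - afBeta Nf Λ (a k))) atTop
      (𝓝 (0 - 0)) :=
    h0.sub hN
  rw [sub_zero] at h2
  have h3 := h.atTop_add h2
  refine h3.congr fun k => ?_
  ring

/-- **Two-loop mismatch, `N_f = 2`:** the `log log` coefficient `b₁/b₀` of the two-flavour profile is
STRICTLY below the pure-gauge one (`230/29 < 102/11` in units of `1/16π²`). [folklore] -/
theorem betaRatio_two_lt_zero : betaCoeff₁ 2 / betaCoeff₀ 2 < betaCoeff₁ 0 / betaCoeff₀ 0 := by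
  unfold betaCoeff₀ betaCoeff₁
  have hπ : 0 < Real.pi ^ 2 := by positivity
  simp only [Nat.cast_zero, Nat.cast_ofNat]
  rw [div_lt_div_iff₀ (by positivity) (by positivity), div_mul_div_comm, div_mul_div_comm,
    div_lt_div_iff_of_pos_right (by positivity)]
  norm_num

/-- **Two-loop mismatch, `N_f = 3`:** `64/9 < 102/11`. [folklore] -/
theorem betaRatio_three_lt_zero : betaCoeff₁ 3 / betaCoeff₀ 3 < betaCoeff₁ 0 / betaCoeff₀ 0 := by
  unfold betaCoeff₀ betaCoeff₁
  have hπ : 0 < Real.pi ^ 2 := by positivity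
  simp only [Nat.cast_zero, Nat.cast_ofNat]
  rw [div_lt_div_iff₀ (by positivity) (by positivity), div_mul_div_comm, div_mul_div_comm,
    div_lt_div_iff_of_pos_right (by positivity)]
  norm_num

/-- **The shift must be two-loop exact.** Even after subtracting the exact one-loop counterterm
`(N_f/12π²) log a_k⁻²` and ANY constant `C` (the freedom `Λ′(Λ, M, N_f)`), the mismatch of the two
profiles still diverges, like `2 (b₁(0)/b₀(0) − b₁(N_f)/b₀(N_f)) log log a_k⁻²`, whenever
`b₁(N_f)/b₀(N_f) < b₁(0)/b₀(0)` (the case `N_f = 2, 3`: `betaRatio_two_lt_zero`, `betaRatio_three_lt_zero`).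
So the coupling hand-over `β′_k` of the bridge must reproduce the sea's contribution to the running
coupling with TWO-LOOP accuracy and `o(1)` error in `β = 2/g₀²`:
`β′_k = reg.β_k + (N_f/12π²) log a_k⁻² + 2(b₁⁰/b₀⁰ − b₁ᴺ/b₀ᴺ) log log a_k⁻² + C + o(1)`. [folklore] -/
theorem residual_after_oneLoop_shift_tendsto_atTop {Nf : ℕ}
    (hr : betaCoeff₁ Nf / betaCoeff₀ Nf < betaCoeff₁ 0 / betaCoeff₀ 0) {Λ Λ' : ℝ} (hΛ : 0 < Λ)
    (hΛ' : 0 < Λ') {a : ℕ → ℝ} (ha : ∀ k, 0 < a k) (ha0 : Tendsto a atTop (𝓝 0)) (C : ℝ) :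
    Tendsto (fun k => afBeta 0 Λ' (a k) - afBeta Nf Λ (a k) -
      (2 * (betaCoeff₀ 0 - betaCoeff₀ Nf) * Real.log ((a k ^ 2)⁻¹) + C)) atTop atTop := by
  set L : ℕ → ℝ := fun k => Real.log ((a k ^ 2)⁻¹) with hLdef
  have hlog : ∀ M : ℝ, 0 < M → ∀ k, Real.log (1 / (a k ^ 2 * M ^ 2)) = L k + Real.log ((M ^ 2)⁻¹) := by
    intro M hM k
    rw [one_div, mul_inv,
      Real.log_mul (inv_ne_zero (pow_ne_zero 2 (ha k).ne')) (inv_ne_zero (pow_ne_zero 2 hM.ne'))]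
  have hL : Tendsto L atTop atTop := by
    have h1 : Tendsto (fun k => a k ^ 2) atTop (𝓝[>] 0) := by
      refine tendsto_nhdsWithin_iff.2 ⟨?_, Eventually.of_forall fun k => pow_pos (ha k) 2⟩
      simpa using ha0.pow 2
    exact Real.tendsto_log_atTop.comp (tendsto_inv_nhdsGT_zero.comp h1)
  -- log (L + c) - log L → 0
  have hsmall : ∀ c : ℝ, Tendsto (fun k => Real.log (L k + c) - Real.log (L k)) atTop (𝓝 0) := by
    intro c
    have hq : Tendsto (fun k => (L k + c) / L k) atTop (𝓝 1) := by
      have h1 : Tendsto (fun k => 1 + c / L k) atTop (𝓝 (1 + 0)) :=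
        tendsto_const_nhds.add (tendsto_const_nhds.div_atTop hL)
      rw [add_zero] at h1
      refine h1.congr' ?_
      filter_upwards [hL.eventually_gt_atTop 0] with k hk
      field_simp
    have hlog1 : Tendsto (fun k => Real.log ((L k + c) / L k)) atTop (𝓝 0) := by
      simpa [Real.log_one] using hq.log one_ne_zero
    refine hlog1.congr' ?_
    filter_upwards [hL.eventually_gt_atTop |c|] with k hk
    have hLk : 0 < L k := lt_of_le_of_lt (abs_nonneg c) hk
    have hLc : 0 < L k + c := by
      have := neg_abs_le c
      linarith
    rw [Real.log_div hLc.ne' hLk.ne']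
  set r0 : ℝ := betaCoeff₁ 0 / betaCoeff₀ 0
  set rN : ℝ := betaCoeff₁ Nf / betaCoeff₀ Nf
  set cΛ : ℝ := Real.log ((Λ ^ 2)⁻¹)
  set cΛ' : ℝ := Real.log ((Λ' ^ 2)⁻¹)
  have hmain : Tendsto (fun k => 2 * (r0 - rN) * Real.log (L k)) atTop atTop :=
    (Real.tendsto_log_atTop.comp hL).const_mul_atTop (by linarith : 0 < 2 * (r0 - rN))
  have hrest : Tendsto (fun k => (2 * betaCoeff₀ 0 * cΛ' - 2 * betaCoeff₀ Nf * cΛ - C) +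
      2 * r0 * (Real.log (L k + cΛ') - Real.log (L k)) -
        2 * rN * (Real.log (L k + cΛ) - Real.log (L k))) atTop
      (𝓝 ((2 * betaCoeff₀ 0 * cΛ' - 2 * betaCoeff₀ Nf * cΛ - C) + 2 * r0 * 0 - 2 * rN * 0)) :=
    (tendsto_const_nhds.add ((hsmall cΛ').const_mul _)).sub ((hsmall cΛ).const_mul _)
  have h := hmain.atTop_add hrest
  refine h.congr fun k => ?_
  simp only [afBeta, hlog Λ hΛ k, hlog Λ' hΛ' k]
  ring


/-- **One-loop matching is not enough (scheme level).** If `β` scales with the `N_f`-flavour profile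
(`N_f = 2, 3`, or any `N_f` with `b₁(N_f)/b₀(N_f) < b₁(0)/b₀(0)`), then the one-loop-shifted couplings
`β′_k := β_k + (N_f/12π²) log a_k⁻² + C` follow NO pure-gauge profile: for every `Λ′ > 0` and every
constant `C`, `β′_k − afBeta 0 Λ′ a_k → −∞`.  The hand-over couplings of the bridge need the two-loop
`log log` term as well. [folklore] -/
theorem oneLoop_shift_not_pureGauge {Nf : ℕ}
    (hr : betaCoeff₁ Nf / betaCoeff₀ Nf < betaCoeff₁ 0 / betaCoeff₀ 0) {a : ℕ → ℝ} (ha : ∀ k, 0 < a k)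
    (ha0 : Tendsto a atTop (𝓝 0)) (β : ℕ → ℝ) {Λ Λ' : ℝ} (hΛ : 0 < Λ) (hΛ' : 0 < Λ')
    (hN : Tendsto (fun k => β k - afBeta Nf Λ (a k)) atTop (𝓝 0)) (C : ℝ) :
    Tendsto (fun k => (β k + (2 * (betaCoeff₀ 0 - betaCoeff₀ Nf) * Real.log ((a k ^ 2)⁻¹) + C)) -
      afBeta 0 Λ' (a k)) atTop atBot := by
  have h := residual_after_oneLoop_shift_tendsto_atTop hr hΛ hΛ' ha ha0 C
  have hneg : Tendsto (fun k => -(afBeta 0 Λ' (a k) - afBeta Nf Λ (a k) -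
      (2 * (betaCoeff₀ 0 - betaCoeff₀ Nf) * Real.log ((a k ^ 2)⁻¹) + C))) atTop atBot :=
    tendsto_neg_atTop_atBot.comp h
  have h2 := hN.add_atBot hneg
  refine h2.congr fun k => ?_
  ring

end Summit.QuantumFields.QCD.Theorems.SeaFactorisationBridge.Negative

end
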